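import Literature.IUT.HodgeTheaters.TemperedCoveringsCor23OfSpecialFibreVerticial
import Literature.IUT.HodgeTheaters.TemperedCoveringsCor23GraphLevelResiduals
import Literature.AnabelianGeometry.SemiGraphs.TemperedDecompositionEmbeddingOfDomination
import Literature.AnabelianGeometry.SemiGraphs.TemperedDecompositionSubgroupsProfinitelyClosedOfInducing
import HarnessLib

/-!
# [IUTchI] Cor. 2.3 (i), (v) at the GENUINE 𝔛-datum for a GENERAL sub-semi-graph `ℍ`: `Π^tp_ℍ` a DECOMPOSITION SUBGROUP
# (`decompSubgroups`), modulo the embedding / domination hypothesis of row «DECOMP-EMB»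

Mochizuki, *Inter-universal Teichmüller theory I: construction of Hodge theaters*, kurims manuscript (May 2020), §2,
Corollary 2.3 (i) p. 47 l. 31–35, (v) p. 48 l. 1–2; proof p. 48 l. 13 ("Assertion (i) follows immediately from Proposition
2.2"), p. 49 l. 38 – p. 50 l. 2 [cite: Mochizuki2012, Cor 2.3 pp.47-50] (D-0012 claim key; series status DISPUTED; nothing of
the series is asserted here); the decomposition groups `Π^tp_ℍ ⊆ Π^tp_𝔾` of a connected sub-semi-graph `ℍ ⊆ 𝔾`, §2 p. 44
l. 39–44.  Mochizuki, *Semi-graphs of anabelioids*, Publ. RIMS **42** (2006), Thm. 3.7 pp. 40–41, Prop. 2.5 (i) p. 27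
[cite: MochizukiSemiAnbd2006, Thm 3.7 pp.40-41].

PROOF-ONLY junction (abc-iut cell; L3 → L5 cone §2 block; seat abc-iut-w4-d052 gen 5; courtesy to the holder-of-record
lineage abc-iut-w5-d028 / abc-iut-L5-lead of the rows `IUTchI:Cor2.3(i)`, `(v)`).  Sequel of abc-iut-w5-d028's
`TemperedCoveringsCor23OfSpecialFibreVerticial.lean` (`ℍ` = ONE vertex, `Π^tp_ℍ` verticial) for a GENERAL sub-semi-graph
`ℍ`, the bridge's parameter `Π^tp_ℍ := TpH` now ranging over the GENUINE carrier `S.chart.decompSubgroups ℍ` (abc-iut's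
`TemperedDecompositionSubgroups.lean`, GAP row G-w5d028-2), print's `Π̂_ℍ :=` the closure of `ι(Π^tp_ℍ)`:

* **(i)** `cor23i_ofSpecialFibre_closureH_of_mem_decompSubgroups_of_isInducing` — the row's exact tempered residual
  «`C_{π₁^temp(G^c)}(Π^tp_ℍ) = Π^tp_ℍ`» is abc-iut-L3's `decompSubgroupsCommensurablyTerminal_of_isInducing`
  (`TemperedDecompositionCommTerminal.lean`: [IUTchI] Prop. 2.2 third inclusion by the tempered route); binders left:
  `hhat : C_{Π̂_𝔾}(Π̂_ℍ) = Π̂_ℍ` (profinite side, as in the one-vertex file), Thm. 3.7's hypotheses and Thm. 3.7 (iii) for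
  `G^c|_ℍ` (`hCIV`; a theorem for finite `ℍ` — `_of_finite`), ONE decomposition homomorphism `φ` with `hind : IsInducing φ`;
  `…_of_dom` — the same with `hind` replaced by the chart-free pointed domination property (DOM) of
  `TemperedDecompositionEmbeddingOfDomination.lean` (row «DECOMP-EMB» part (B); part (C) = abc-iut-L3-d1);
* **(v)** `cor23v_ofSpecialFibre_closureH_of_mem_decompSubgroups_of_isInducing` / `…_of_dom` — `Δ̂_{X,ℍ} ∩ Δ^tp_X =
  Δ^tp_{X,ℍ}` ⟸ `ι⁻¹(Π̂_ℍ) = Π^tp_ℍ` (`cor23v_iff_comap`) = abc-iut-w5-d240's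
  `comap_topologicalClosure_map_eq_of_mem_decompSubgroups_of_isInducing` under its graph hypotheses (finite coherent
  Prop-3.6 graphs `G^c`, `G^c|_ℍ`, a closed edge of `G^c`) and `hind` (resp. (DOM)).

HONEST RESIDUAL at general `ℍ`: `hhat` (FACT route F-1458 / (P3)), the hypotheses bundles for `G^c|_ℍ`, and the embedding
hypothesis `hind` ⟸ (DOM) ⟸ (DOM-fin) (row «DECOMP-EMB», in flight).  Model-RELATIVE; typed ≠ discharged; a binder is an
assumption label; no definition, no new `Prop` fact; nothing here bears on [IUTchIII] Cor. 3.12 or asserts that abc is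
proved or refuted.
-/

noncomputable section

namespace Literature.IUT.HodgeTheaters

open _root_.Topology
open scoped Pointwise
open Literature.AnabelianGeometry.SemiGraphs
open Literature.AnabelianGeometry.SemiGraphs.ProfiniteSemiGraph (TemperedPiChart CompactInVerticialAt
  compactInVerticialFin_holds)
open Literature.AnabelianGeometry.SemiGraphs.ProfiniteSemiGraph.TemperedPiChart
  (decompSubgroupsCommensurablyTerminal_of_isInducing decompSubgroupsCommensurablyTerminal_of_dom
   comap_topologicalClosure_map_eq_of_mem_decompSubgroups_of_isInducing IsDecompHom.isInducing_of_dom)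
open Literature.AnabelianGeometry.AbsoluteAnabelian (IsCommensurablyTerminal)

namespace StableCurveTemperedData

variable {p : ℕ} [Fact p.Prime] (X : TemperedCurve p) (d : X.GroupLevelData)
  (S : SpecialFibreData (X.toTemperedArithmeticGroup d)) (h36 : S.Gc.Prop36Hypotheses)
  (Sigma SigmaHat : Set ℕ) (hsub : Sigma ⊆ SigmaHat) (hne : Sigma.Nonempty)
  (hprime : ∀ q ∈ SigmaHat, q.Prime) (hp : p ∉ Sigma)
  (TpH : Subgroup S.chart.G)
  (cuspMeetsH : {x : X.Pt // X.IsCusp x} → Prop)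

/-! ### A. Cor. 2.3 (i): the tempered-side law for a decomposition subgroup of a general `ℍ` -/

/-- **Row `IUTchI:Cor2.3(i)` at the genuine datum for `Π^tp_ℍ := TpH ∈ decompSubgroups S.chart ℍ`, GENERAL `ℍ`, from
`hhat` and the EMBEDDING hypothesis**: the tempered-side law `C_{π₁^temp(G^c)}(Π^tp_ℍ) = Π^tp_ℍ` (the exact residual #1 of
the row) is abc-iut-L3's `decompSubgroupsCommensurablyTerminal_of_isInducing` ([IUTchI] Prop. 2.2 third inclusion by the
tempered route: Thm. 3.7 (ii) for `G^c`, Thm. 3.7 (iii) at `G^c|_ℍ`, compact lifting along an inducing decomposition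
homomorphism `φ`); remaining binders: `hhat : C_{Π̂_𝔾}(Π̂_ℍ) = Π̂_ℍ` (profinite side), Thm. 3.7's hypotheses + (iii) for
`G^c|_ℍ`, and `hind : IsInducing φ` (row «DECOMP-EMB»). [cite: Mochizuki2012, Cor 2.3(i) pp.47-48] -/
theorem cor23i_ofSpecialFibre_closureH_of_mem_decompSubgroups_of_isInducing {H : S.Gc.graph.Subgraph}
    (hTpH : TpH ∈ S.chart.decompSubgroups H) (h37H : (S.Gc.restrict H).Thm37Hypotheses)
    (hCIV : CompactInVerticialAt (S.Gc.restrict H)) {c' : TemperedPiChart (S.Gc.restrict H)}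
    {φ : c'.G →ₜ* S.chart.G} (hφ : S.chart.IsDecompHom H c' φ) (hind : Topology.IsInducing φ)
    (hhat : IsCommensurablyTerminal ((TpH.map (TemperedGraphGroupData.exists_completion_of_prop36 S.Gc h36
      S.chart).choose_spec.choose.toMonoidHom).topologicalClosure)) :
    (ofSpecialFibre X d S h36 Sigma SigmaHat hsub hne hprime hp TpH
      ((TpH.map (TemperedGraphGroupData.exists_completion_of_prop36 S.Gc h36
        S.chart).choose_spec.choose.toMonoidHom).topologicalClosure) (Subgroup.le_topologicalClosure _) cuspMeetsH).Cor23i :=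
  (ofSpecialFibre X d S h36 Sigma SigmaHat hsub hne hprime hp TpH
      ((TpH.map (TemperedGraphGroupData.exists_completion_of_prop36 S.Gc h36
        S.chart).choose_spec.choose.toMonoidHom).topologicalClosure) (Subgroup.le_topologicalClosure _)
        cuspMeetsH).cor23i_of_commTerminal
    (decompSubgroupsCommensurablyTerminal_of_isInducing S.hyp h37H hCIV hφ hind TpH hTpH) hhat

/-- **The same with (DOM) in place of the embedding hypothesis** (pointed domination of the tempered coverings of `G^c|_ℍ`
by sub-coverings of restrictions of tempered coverings of `G^c` ⇒ `φ` induces the topology,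
abc-iut-L3 `IsDecompHom.isInducing_of_dom`). [cite: Mochizuki2012, Cor 2.3(i) pp.47-48] -/
theorem cor23i_ofSpecialFibre_closureH_of_mem_decompSubgroups_of_dom {H : S.Gc.graph.Subgraph}
    (hTpH : TpH ∈ S.chart.decompSubgroups H) (h37H : (S.Gc.restrict H).Thm37Hypotheses)
    (hCIV : CompactInVerticialAt (S.Gc.restrict H)) {c' : TemperedPiChart (S.Gc.restrict H)}
    {φ : c'.G →ₜ* S.chart.G} (hφ : S.chart.IsDecompHom H c' φ)
    (hdom : ∀ (T : ProfiniteSemiGraph.BTempCat (S.Gc.restrict H)) (v : H.toSemiGraph.Vertex)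
      (t : (T.obj.SV v).obj.V),
      ∃ (S' : ProfiniteSemiGraph.BTempCat S.Gc) (C : ProfiniteSemiGraph.BTempCat (S.Gc.restrict H))
        (ι : C ⟶ (S.Gc.btempRestrict H).obj S') (f : C ⟶ T) (s : (C.obj.SV v).obj.V),
        Function.Injective (ι.hom.fV v).hom.hom ∧ (f.hom.fV v).hom.hom s = t)
    (hhat : IsCommensurablyTerminal ((TpH.map (TemperedGraphGroupData.exists_completion_of_prop36 S.Gc h36
      S.chart).choose_spec.choose.toMonoidHom).topologicalClosure)) :
    (ofSpecialFibre X d S h36 Sigma SigmaHat hsub hne hprime hp TpH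
      ((TpH.map (TemperedGraphGroupData.exists_completion_of_prop36 S.Gc h36
        S.chart).choose_spec.choose.toMonoidHom).topologicalClosure) (Subgroup.le_topologicalClosure _) cuspMeetsH).Cor23i :=
  cor23i_ofSpecialFibre_closureH_of_mem_decompSubgroups_of_isInducing X d S h36 Sigma SigmaHat hsub hne hprime hp TpH
    cuspMeetsH hTpH h37H hCIV hφ (hφ.isInducing_of_dom h37H hdom) hhat

/-- **Finite `ℍ`**: Thm. 3.7 (iii) at `G^c|_ℍ` is the tree's `compactInVerticialFin_holds`, so the binder `hCIV` disappears.
[cite: Mochizuki2012, Cor 2.3(i) pp.47-48] -/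
theorem cor23i_ofSpecialFibre_closureH_of_mem_decompSubgroups_of_isInducing_of_finite {H : S.Gc.graph.Subgraph}
    [hV : Finite H.toSemiGraph.Vertex] [hE : Finite H.toSemiGraph.Edge]
    (hTpH : TpH ∈ S.chart.decompSubgroups H) (h37H : (S.Gc.restrict H).Thm37Hypotheses)
    {c' : TemperedPiChart (S.Gc.restrict H)} {φ : c'.G →ₜ* S.chart.G} (hφ : S.chart.IsDecompHom H c' φ)
    (hind : Topology.IsInducing φ)
    (hhat : IsCommensurablyTerminal ((TpH.map (TemperedGraphGroupData.exists_completion_of_prop36 S.Gc h36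
      S.chart).choose_spec.choose.toMonoidHom).topologicalClosure)) :
    (ofSpecialFibre X d S h36 Sigma SigmaHat hsub hne hprime hp TpH
      ((TpH.map (TemperedGraphGroupData.exists_completion_of_prop36 S.Gc h36
        S.chart).choose_spec.choose.toMonoidHom).topologicalClosure) (Subgroup.le_topologicalClosure _) cuspMeetsH).Cor23i :=
  cor23i_ofSpecialFibre_closureH_of_mem_decompSubgroups_of_isInducing X d S h36 Sigma SigmaHat hsub hne hprime hp TpH
    cuspMeetsH hTpH h37H (@compactInVerticialFin_holds (S.Gc.restrict H) hV hE) hφ hind hhat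

/-! ### B. Cor. 2.3 (v): profinite closedness of a decomposition subgroup of a general `ℍ` -/

/-- **Row `IUTchI:Cor2.3(v)` at the genuine datum for `Π^tp_ℍ := TpH ∈ decompSubgroups S.chart ℍ`, GENERAL (finite)
`ℍ`, from the EMBEDDING hypothesis**: `Δ̂_{X,ℍ} ∩ Δ^tp_X = Δ^tp_{X,ℍ}` ⟸ the 𝔾-level identity `ι⁻¹(Π̂_ℍ) = Π^tp_ℍ`
(`cor23v_iff_comap`), which is abc-iut-w5-d240's `comap_topologicalClosure_map_eq_of_mem_decompSubgroups_of_isInducing`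
([SemiAnbd] Cor. 2.7 (i) on the profinite side + M. Hall separability + closedness of decomposition subgroups along an
inducing `φ`, abc-iut-L3) under its graph hypotheses (finite coherent Prop-3.6 graphs `G^c`, `G^c|_ℍ`, a closed edge of
`G^c`) and `hind : IsInducing φ` (row «DECOMP-EMB»). [cite: Mochizuki2012, Cor 2.3(v) pp.48-50] -/
theorem cor23v_ofSpecialFibre_closureH_of_mem_decompSubgroups_of_isInducing {H : S.Gc.graph.Subgraph}
    [Finite S.Gc.graph.Vertex] [Finite S.Gc.graph.Edge] [Finite (S.Gc.restrict H).graph.Vertex]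
    [Finite (S.Gc.restrict H).graph.Edge] (hcoh : S.Gc.IsCoherent)
    (hcl : ∃ e : S.Gc.graph.Edge, S.Gc.graph.IsClosedEdge e) (h36' : (S.Gc.restrict H).Prop36Hypotheses)
    (hcoh' : (S.Gc.restrict H).IsCoherent) (hTpH : TpH ∈ S.chart.decompSubgroups H)
    {c' : TemperedPiChart (S.Gc.restrict H)} {φ : c'.G →ₜ* S.chart.G} (hφ : S.chart.IsDecompHom H c' φ)
    (hind : Topology.IsInducing φ) :
    (ofSpecialFibre X d S h36 Sigma SigmaHat hsub hne hprime hp TpH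
      ((TpH.map (TemperedGraphGroupData.exists_completion_of_prop36 S.Gc h36
        S.chart).choose_spec.choose.toMonoidHom).topologicalClosure) (Subgroup.le_topologicalClosure _) cuspMeetsH).Cor23v :=
  (ofSpecialFibre X d S h36 Sigma SigmaHat hsub hne hprime hp TpH
      ((TpH.map (TemperedGraphGroupData.exists_completion_of_prop36 S.Gc h36
        S.chart).choose_spec.choose.toMonoidHom).topologicalClosure) (Subgroup.le_topologicalClosure _)
        cuspMeetsH).cor23v_iff_comap.2
    (comap_topologicalClosure_map_eq_of_mem_decompSubgroups_of_isInducing h36 hcoh hcl h36' hcoh' S.chart hφ hind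
      (TemperedGraphGroupData.exists_completion_of_prop36 S.Gc h36 S.chart).choose_spec.choose_spec.1 hTpH)

/-- **The same with (DOM) in place of the embedding hypothesis.** [cite: Mochizuki2012, Cor 2.3(v) pp.48-50] -/
theorem cor23v_ofSpecialFibre_closureH_of_mem_decompSubgroups_of_dom {H : S.Gc.graph.Subgraph}
    [Finite S.Gc.graph.Vertex] [Finite S.Gc.graph.Edge] [Finite (S.Gc.restrict H).graph.Vertex]
    [Finite (S.Gc.restrict H).graph.Edge] (hcoh : S.Gc.IsCoherent)
    (hcl : ∃ e : S.Gc.graph.Edge, S.Gc.graph.IsClosedEdge e) (h36' : (S.Gc.restrict H).Prop36Hypotheses)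
    (hcoh' : (S.Gc.restrict H).IsCoherent) (h37H : (S.Gc.restrict H).Thm37Hypotheses)
    (hTpH : TpH ∈ S.chart.decompSubgroups H)
    {c' : TemperedPiChart (S.Gc.restrict H)} {φ : c'.G →ₜ* S.chart.G} (hφ : S.chart.IsDecompHom H c' φ)
    (hdom : ∀ (T : ProfiniteSemiGraph.BTempCat (S.Gc.restrict H)) (v : H.toSemiGraph.Vertex)
      (t : (T.obj.SV v).obj.V),
      ∃ (S' : ProfiniteSemiGraph.BTempCat S.Gc) (C : ProfiniteSemiGraph.BTempCat (S.Gc.restrict H))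
        (ι : C ⟶ (S.Gc.btempRestrict H).obj S') (f : C ⟶ T) (s : (C.obj.SV v).obj.V),
        Function.Injective (ι.hom.fV v).hom.hom ∧ (f.hom.fV v).hom.hom s = t) :
    (ofSpecialFibre X d S h36 Sigma SigmaHat hsub hne hprime hp TpH
      ((TpH.map (TemperedGraphGroupData.exists_completion_of_prop36 S.Gc h36
        S.chart).choose_spec.choose.toMonoidHom).topologicalClosure) (Subgroup.le_topologicalClosure _) cuspMeetsH).Cor23v :=
  cor23v_ofSpecialFibre_closureH_of_mem_decompSubgroups_of_isInducing X d S h36 Sigma SigmaHat hsub hne hprime hp TpH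
    cuspMeetsH hcoh hcl h36' hcoh' hTpH hφ (hφ.isInducing_of_dom h37H hdom)

end StableCurveTemperedData

end Literature.IUT.HodgeTheaters
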